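import Literature.NumberTheory.EllipticCurves.RationalPointInfiniteOrderCriteria
import Literature.NumberTheory.EllipticCurves.Rank1Residual.X11RankOneCertificates.Minimality
import HarnessLib

/-!
# R1CERT rows in the kernel: `1 ≤ rank_ℤ E(ℚ)` for rank-1 X4 cells from one kind-NL row each

HONEST FRAMING (cell `b2b-bsdres`, home `run/shared/lean/b2b/bsd-rank1-residual/`): the goal of the
cell is to DELETE the COMBINATION-SHAPED residual classes for ALL analytic-rank `≤ 1` curves over `ℚ` —
"full BSD formula for every rank `≤ 1` curve in class C" assembled STRICTLY from published theorems —
so that the rank-`≤ 1` remainder becomes exactly the CONSTRUCTION-SHAPED classes, which are TYPED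
(missing-input `Prop`s), NOT attempted; this is not "finishing BSD". Class X4 stays CONSTRUCTION-SHAPED;
everything here is PER CURVE instrumentation (a rational point of infinite order, exhibited); no class
theorem, no named fact, nothing is booked, no mark moves.

WHAT THIS FILE IS: the kernel template for the class-closure instrument column `r1cert` (cc-typer-2
GEN 8 format, kind `NL`; table `class-closure/relations/R1CERT-NL-v1.eng2.tsv.xz`, sha16
`6a183d7857e2f242`, cc-eng-2 GEN 7: for every Cremona class of rank `≥ 1` the smallest multiple
`n·G₁` of Cremona's first generator on the reduced global minimal model whose `x`-denominator is
divisible by an odd prime `ℓ`; two independent programs agree on all `1 374 002` rows; report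
`class-closure/eng-2/E3R1-1.md` §2). ONE ROW ↦ ONE CALL of the tree checker
`one_le_mordellWeilRank_of_dvd_den` (Silverman AEC VII.3.4: on a `ℤ`-minimal model a torsion point has
`den x ∣ 4`), after (i) `IsElliptic` by `norm_num`, (ii) `IsGloballyMinimal` by Silverman's criterion
`isGloballyMinimal_of_int_criterion` through the small generic lemma `int_criterion_of_bound` below
(no `q¹² ∣ Δ ∧ q⁴ ∣ c₄`: only primes `q < B` with `|Δ| < B¹²` need checking, by `decide`), (iii) the
curve equation at the point by `norm_num`, (iv) `ℓ ∣ den x` by `decide +kernel` (plain `decide` does not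
reduce `Rat.den`). Instances: the two OPEN rank-1 X4 cells at `p = 3` of folder O7 with the shortest
rows — `25380q1 = [0,0,0,123,21]` (Kodaira II at `3`, `v₃(Δ) = 3`, wild, `e = 12`) and
`42444e1 = [0,0,0,72,36]` (Kodaira IV, `v₃(Δ) = 6`, `e = 6`), both with `n = 3`, `ℓ = 3`.
-/

set_option autoImplicit false

namespace Summit.BirchSwinnertonDyer.Rank1Residual.X4.R1CertTemplate

open WeierstrassCurve Literature.NumberTheory.EllipticCurves
open Literature.NumberTheory.EllipticCurves.Rank1Residual.X11RankOneCertificates (discOf c4Of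
  isGloballyMinimal_of_int_criterion)

/-! ### Generic: Silverman's criterion from finitely many primes -/

/-- **Silverman's minimality criterion needs only the primes below a twelfth-root bound.** If
`0 < |Δ| < B¹²` and no prime `q < B` has `q¹² ∣ Δ ∧ q⁴ ∣ c₄`, then no prime at all does (a prime
`q ≥ B` with `q¹² ∣ Δ` would force `B¹² ≤ q¹² ≤ |Δ|`). The hypothesis `hsmall` is a `decide` goal for a
numeric row. [folklore] -/
theorem int_criterion_of_bound (a : List ℤ) (B : ℕ) (h0 : discOf a ≠ 0)
    (hB : (discOf a).natAbs < B ^ 12)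
    (hsmall : ∀ q < B, q.Prime → ¬ (q ^ 12 ∣ (discOf a).natAbs ∧ q ^ 4 ∣ (c4Of a).natAbs)) :
    ∀ q : ℕ, q.Prime → ¬ ((q : ℤ) ^ 12 ∣ discOf a ∧ (q : ℤ) ^ 4 ∣ c4Of a) := by
  intro q hq ⟨h12, h4⟩
  have h12' : q ^ 12 ∣ (discOf a).natAbs := by
    rw [← Int.natCast_dvd]; exact_mod_cast h12
  have h4' : q ^ 4 ∣ (c4Of a).natAbs := by
    rw [← Int.natCast_dvd]; exact_mod_cast h4
  by_cases hqB : q < B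
  · exact hsmall q hqB hq ⟨h12', h4'⟩
  · have hpos : 0 < (discOf a).natAbs := Int.natAbs_pos.mpr h0
    have hle : q ^ 12 ≤ (discOf a).natAbs := Nat.le_of_dvd hpos h12'
    have hge : B ^ 12 ≤ q ^ 12 := Nat.pow_le_pow_left (by omega) 12
    omega

/-! ### Row `25380q1` (O7, X4, rank 1, OPEN at R203; Kodaira II at 3, e = 12) -/

/-- `25380q1 = [0,0,0,123,21]` (Cremona's reduced minimal model). [folklore] -/
def W25380q1 : WeierstrassCurve ℚ := ⟨0, 0, 0, 123, 21⟩

/-- `25380q1` is elliptic (`Δ = −119 286 000 ≠ 0`). [folklore] -/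
instance : W25380q1.IsElliptic := ⟨by
  rw [isUnit_iff_ne_zero]
  norm_num [W25380q1, WeierstrassCurve.Δ, WeierstrassCurve.b₂, WeierstrassCurve.b₄,
    WeierstrassCurve.b₆, WeierstrassCurve.b₈]⟩

/-- `25380q1` is globally minimal: `|Δ| = 119 286 000 < 5¹²` and neither `2¹²` nor `3¹²` divides `Δ`
(`Δ = −2⁴·3³·5³·47²`). [folklore] -/
instance : W25380q1.IsGloballyMinimal := by
  have h := isGloballyMinimal_of_int_criterion 0 0 0 123 21
    (int_criterion_of_bound [0, 0, 0, 123, 21] 5 (by decide) (by decide) (by decide))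
  have hW : (⟨((0 : ℤ) : ℚ), ((0 : ℤ) : ℚ), ((0 : ℤ) : ℚ), ((123 : ℤ) : ℚ), ((21 : ℤ) : ℚ)⟩ :
      WeierstrassCurve ℚ) = W25380q1 := by
    simp [W25380q1]
  rw [hW] at h
  exact h

/-- R1CERT row of `25380q`: `n = 3`, `P = 3·G₁ = (4/9, 235/27)` lies on the curve. [folklore] -/
theorem equation_25380q1 : W25380q1.toAffine.Equation (4 / 9) (235 / 27) := by
  rw [Affine.equation_iff]
  norm_num [W25380q1]

/-- **`1 ≤ rank_ℤ E(ℚ)` for `25380q1`** from its R1CERT row (kind NL, `ℓ = 3 ∣ den (4/9)`). [folklore] -/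
theorem one_le_rank_25380q1 : 1 ≤ W25380q1.mordellWeilRank :=
  haveI : Fact (Nat.Prime 3) := ⟨by norm_num⟩
  one_le_mordellWeilRank_of_dvd_den W25380q1 3 (by norm_num)
    ((Affine.equation_iff_nonsingular (W := W25380q1)).mp equation_25380q1) (by decide +kernel)

/-! ### Row `42444e1` (O7, X4, rank 1, OPEN at R203; Kodaira IV at 3, e = 6) -/

/-- `42444e1 = [0,0,0,72,36]` (Cremona's reduced minimal model). [folklore] -/
def W42444e1 : WeierstrassCurve ℚ := ⟨0, 0, 0, 72, 36⟩

/-- `42444e1` is elliptic (`Δ = −24 447 744 ≠ 0`). [folklore] -/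
instance : W42444e1.IsElliptic := ⟨by
  rw [isUnit_iff_ne_zero]
  norm_num [W42444e1, WeierstrassCurve.Δ, WeierstrassCurve.b₂, WeierstrassCurve.b₄,
    WeierstrassCurve.b₆, WeierstrassCurve.b₈]⟩

/-- `42444e1` is globally minimal: `|Δ| = 24 447 744 < 5¹²`, `Δ = −2⁸·3⁶·131`. [folklore] -/
instance : W42444e1.IsGloballyMinimal := by
  have h := isGloballyMinimal_of_int_criterion 0 0 0 72 36
    (int_criterion_of_bound [0, 0, 0, 72, 36] 5 (by decide) (by decide) (by decide))
  have hW : (⟨((0 : ℤ) : ℚ), ((0 : ℤ) : ℚ), ((0 : ℤ) : ℚ), ((72 : ℤ) : ℚ), ((36 : ℤ) : ℚ)⟩ :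
      WeierstrassCurve ℚ) = W42444e1 := by
    simp [W42444e1]
  rw [hW] at h
  exact h

/-- R1CERT row of `42444e`: `n = 3`, `P = 3·G₁ = (37/9, 541/27)` lies on the curve. [folklore] -/
theorem equation_42444e1 : W42444e1.toAffine.Equation (37 / 9) (541 / 27) := by
  rw [Affine.equation_iff]
  norm_num [W42444e1]

/-- **`1 ≤ rank_ℤ E(ℚ)` for `42444e1`** from its R1CERT row (kind NL, `ℓ = 3 ∣ den (37/9)`). [folklore] -/
theorem one_le_rank_42444e1 : 1 ≤ W42444e1.mordellWeilRank :=
  haveI : Fact (Nat.Prime 3) := ⟨by norm_num⟩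
  one_le_mordellWeilRank_of_dvd_den W42444e1 3 (by norm_num)
    ((Affine.equation_iff_nonsingular (W := W42444e1)).mp equation_42444e1) (by decide +kernel)

end Summit.BirchSwinnertonDyer.Rank1Residual.X4.R1CertTemplate
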